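import Summits.BirchSwinnertonDyer.BirchSwinnertonDyer.Theorems.ClassRecordThreeRegCertKernel
import Summits.BirchSwinnertonDyer.BirchSwinnertonDyer.Theorems.ClassRecordThreeRegCertKernelO3Deep
import HarnessLib

/-!
# Route `ClassRecordThree`, crux `SchneiderAtThree` (item 19106): the THIRD-ORDER REG3CERT kernel certificate checker
# at a VERY DEEP certificate point (`v₃(e(Q)) = K ≥ 3`, `v₃(h(Q)) ≤ 3`) — from one row's integers to `RegMult.CertNonsplit W 3 Q 1`
# (cell `bsd-stepL`, seat `bsd-stepL-reg3-eng` g3; `--supports stmt-BirchSwinnertonDyer-19106`)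

HONEST FRAMING: BSD is not proved by any of this; nothing here closes the crux; Schneider's conjecture (barrier
`PAdicHeightNondegeneracy`) is asserted NOWHERE; every application is ONE curve. Third-order twin of
`…O2DeepCert.certNonsplit_of_deepCertO2` (for `K ≥ 3`): the bundled integer hypothesis carries, besides the model, the
point and the gcd reduction test, `3 ≤ K`, one residue `u` with `81 ∣ (ae')²(b − a₁3ᴷae') − ub³`, `3 ∤ u`, `3 ∣ u² − 1`
and the certificate **`3⁵ ∤ 6E − 3E² + 2E³ − 6V + 3V² − 2V³`** (`E = e'⁴ − 1`, `V = u² − 1`); the height inequality is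
`heightFourOneCoord_ne_zero_of_deepCertO3`. Theorems only (0 defs, 0 facts). References: [SteinWuthrich2013] §4.2;
[MazurSteinTate2006] §1; [SilvermanAEC2009] VII.3.4.
-/

open scoped Classical

open WeierstrassCurve Literature.NumberTheory.EllipticCurves
  Literature.NumberTheory.EllipticCurves.Rank1Residual
  Literature.NumberTheory.EllipticCurves.SteinWuthrich2013
  Summit.BirchSwinnertonDyer.Rank1Residual
  Summit.BirchSwinnertonDyer.Rank1Residual.X11b

namespace Summit.BirchSwinnertonDyer.Rank1Residual.X11b.RegMult.KernelCert

/-- **`RegMult.CertNonsplit W 3 Q 1` from a THIRD-ORDER VERY DEEP REG3CERT certificate (`v₃(e(Q)) = K ≥ 3`).** For the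
integer model `W = ⟨a₁,…,a₆⟩` (globally minimal, elliptic) and a point `Q = (x, y) = (a/e², b/e³)` of `W` with
`e = 3^K e'`, the hypothesis `H` bundles the row's integer facts (`c₄`, `c₆`, `3 ∤ c₆`, `9 ∣ c₄ + γc₆`, `3 ∤ γ`, `3 ≤ K`,
`3 ∤ e'`, `3 ∤ b`, `gcd(a, e) = 1`, the gcd reduction test, `81 ∣ (ae')²(b − a₁3ᴷae') − ub³`, `3 ∤ u`, `3 ∣ u² − 1`, and
**`3⁵ ∤ 6E − 3E² + 2E³ − 6V + 3V² − 2V³`**), decided per row by ONE `norm_num`; conclusion: admissibility of `Q = 1 • Q`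
at `3` and `heightFourOneCoord W 3 q x y ≠ 0` for every `‖q‖₃ < 1` (`heightFourOneCoord_ne_zero_of_deepCertO3`).
Per curve; nothing class-wide. [cite: SteinWuthrich2013, §4.2] [cite: MazurSteinTate2006, §1] [cite: SilvermanAEC2009, VII.3.4] -/
theorem certNonsplit_of_deepCertO3 (W : WeierstrassCurve ℚ) {a₁ a₂ a₃ a₄ a₆ : ℤ} (hW : W = ⟨a₁, a₂, a₃, a₄, a₆⟩)
    [W.IsElliptic] [W.IsGloballyMinimal] {a b c4 c6 γ u : ℤ} {e' K n : ℕ}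
    (H : c4 = (a₁ ^ 2 + 4 * a₂) ^ 2 - 24 * (2 * a₄ + a₁ * a₃) ∧
      c6 = -(a₁ ^ 2 + 4 * a₂) ^ 3 + 36 * (a₁ ^ 2 + 4 * a₂) * (2 * a₄ + a₁ * a₃) - 216 * (a₃ ^ 2 + 4 * a₆) ∧
      ¬ (3 : ℤ) ∣ c6 ∧ (9 : ℤ) ∣ c4 + γ * c6 ∧ ¬ (3 : ℤ) ∣ γ ∧ 3 ≤ K ∧ ¬ (3 : ℤ) ∣ e' ∧ ¬ (3 : ℤ) ∣ b ∧
      Nat.Coprime a.natAbs (3 ^ K * e') ∧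
      Int.gcd (2 * b + a₁ * a * (3 ^ K * e' : ℕ) + a₃ * (3 ^ K * e' : ℕ) ^ 3)
        (a₁ * b * (3 ^ K * e' : ℕ) - (3 * a ^ 2 + 2 * a₂ * a * (3 ^ K * e' : ℕ) ^ 2 + a₄ * (3 ^ K * e' : ℕ) ^ 4)) ∣
        (3 ^ K * e') ^ n ∧
      (81 : ℤ) ∣ (a * e') ^ 2 * (b - a₁ * 3 ^ K * a * e') - u * b ^ 3 ∧ ¬ (3 : ℤ) ∣ u ∧ (3 : ℤ) ∣ u ^ 2 - 1 ∧
      ¬ (243 : ℤ) ∣ 6 * ((e' : ℤ) ^ 4 - 1) - 3 * ((e' : ℤ) ^ 4 - 1) ^ 2 + 2 * ((e' : ℤ) ^ 4 - 1) ^ 3 -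
        6 * (u ^ 2 - 1) + 3 * (u ^ 2 - 1) ^ 2 - 2 * (u ^ 2 - 1) ^ 3)
    {x y : ℚ} (hx : x = a / ((3 ^ K * e' : ℕ) : ℚ) ^ 2) (hy : y = b / ((3 ^ K * e' : ℕ) : ℚ) ^ 3)
    (h : W.toAffine.Nonsingular x y) : RegMult.CertNonsplit W 3 (.some x y h) 1 := by
  obtain ⟨hc4, hc6, h3c6, hγ, h3γ, hK, h3e', h3b, hcop, hgcd, hu, h3u, h3u2, hcert⟩ := H
  have he'0 : e' ≠ 0 := by rintro rfl; exact h3e' (by simp)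
  have he0 : (3 ^ K * e' : ℕ) ≠ 0 := by positivity
  have h3e : 3 ∣ 3 ^ K * e' := dvd_mul_of_dvd_left (dvd_pow_self 3 (by omega)) e'
  have hx1 : 1 < ‖(x : ℚ_[3])‖ := by
    haveI : Fact (Nat.Prime 3) := ⟨Nat.prime_three⟩
    exact (one_lt_norm_ratCast_iff 3 x).mpr (padicValRat_x_neg he0 hx hcop h3e)
  have hadm : W.IsAdmissible 3 (.some x y h) :=
    isAdmissible_of_one_lt_norm (by norm_num) h hx1 (hasNonsingularReductionAt_of_gcd W hW he0 hx hy hcop hgcd)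
  refine ⟨by rw [one_smul]; exact hadm, fun q _ hq1 _ => ?_⟩
  rw [one_smul]
  exact heightFourOneCoord_ne_zero_of_deepCertO3 W (baseChange_a₁_eq W hW) (baseChange_c₄_eq W hW hc4)
    (baseChange_c₆_eq W hW hc6) h3c6 hγ h3γ hK h3e' h3b hcop hx hy hu h3u h3u2 hcert hq1

end Summit.BirchSwinnertonDyer.Rank1Residual.X11b.RegMult.KernelCert
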